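import Summits.BirchSwinnertonDyer.Rank1Residual.Supersingular.GoodThreeKimTamagawaDefectOPEN
import HarnessLib

/-!
# Good `3` with the `3`-adic tower, analytic rank ZERO (class X8 = N6; X7@3, X6@3): the EXACT BOUNDARY
# `BSD(E,3) ⟺ ∂^{(∞)}(δ̃) = ord₃ ∏ c_ℓ ⟺ ∂^{(∞)}(δ̃) ≤ ord₃ ∏ c_ℓ ⟺` ONE Kurihara number non-zero modulo
# `3^k` at a cyclic level of `𝒩_k`, `k ≤ ord₃ ∏ c_ℓ + 1 — CONDITIONAL on the announced Kim 2025
# (arXiv:2505.09121, PREPRINT) structure clause; X8 / X7@3 / X6@3 instances with the tower FED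
# (cell `b2b-bsdres`, supersingular family, prover B = unit `b2b-bsdres-additive-p3`, gen 18; CLASS-CLOSURE
# §3.12 N6 = X8 ∧ `r = 0` (class lead additive-p3), §3.11 N5@3, §3.16 N4@3; FILE 2 of 2, sequel of
# `Supersingular/GoodThreeKimTamagawaDefectOPEN.lean`)

HONEST FRAMING (run/shared/lean/b2b/bsd-rank1-residual/, verbatim in every file): the goal of the
cell is to DELETE the COMBINATION-SHAPED residual classes of the Birch–Swinnerton-Dyer formula for
ALL analytic-rank `≤ 1` elliptic curves over `ℚ` — "full BSD formula for every rank `≤ 1` curve in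
class `C`" assembled STRICTLY from published theorems — so that the rank-`≤ 1` remainder becomes
exactly the CONSTRUCTION-SHAPED classes, which are TYPED (missing-input `Prop`s), NOT attempted.
This is not "finishing BSD". Research route; no claim beyond the stated classes. X8 / X7 / X6 stay
CONSTRUCTION-SHAPED; per pair only; nothing about any curve is asserted; nothing is booked; no mark
of RESIDUAL-MAP §I (N4–N6) moves. An ANNOUNCED preprint enters ONLY as an explicitly labelled OPEN
hypothesis: every theorem below carrying `hK25s : Kim2025.thm11_kimShaLength_of_integralPeriod_OPEN`
is CONDITIONAL on the unrefereed arXiv:2505.09121v1 (C.-H. Kim, appendix with R. Pollack, 2025;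
Thm. 1.1 ("BSD") second clause; its `p = 3` Kolyvagin-system input, Sakamoto, JTNB 36 (2024), IS
refereed). Theorems only (compositions of tree theorems BY NAME); no definition, no named fact (debt 0).

## What is proved (notation and standing hypotheses as in FILE 1: good `3`, `r_an = 0`, the `3`-adic
tower, a parametrisation datum `D` used only through its newform `D.f` — NO Manin binder —, the
PUBLISHED period transfer `h3per`, GZK `hGZK`, modularity `hmod`; `t = ord₃ ∏_ℓ c_ℓ`)

* §3 **EXACT BOUNDARY**: `BSD(E,3) ⟺ X4.KimTamagawaDefectAt W 3 D.f` (Kim's Conjecture 1.10 at the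
  pair; `hK25s` alone) `⟺ X4.KimTamagawaDefectLeAt W 3 D.f` (`hK25s` + Wuthrich 2014 Prop. 21 `hW`,
  PUBLISHED, through FILE 1's `≥` half) `⟺ ∃` a cyclic Kolyvagin level `n ∈ 𝒩_k`, `1 ≤ k ≤ t + 1`, and
  surjective discrete logarithms `ψ` with `kuriharaNumber D.f (3^k) n ψ ≠ 0`. So ONE level-`3^{t+1}`
  certificate gives `BSD(E,3)` — BOTH halves, the upper one Wuthrich's —; on `3 ∤ ∏ c_ℓ` rows
  (`k = 1`) this is gen 17's unit route (`GoodThree.bsdp_of_kim2025_OPEN_of_kuriharaUnitAt`, there with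
  a Manin binder, here without); on N6's TAM-DEFECT rows (`3 ∣ ∏ c_ℓ`; obsanat `N6/pairs.tsv`: 7 cells,
  e.g. 9950f1 `c = 6`, 12155c1 `c = 3`, 17200bj1 `c = 12`, 18515u1 `c = 6`) it is the level-`𝒩₂`
  reading Kim–Pollack App. §8.1.2 print for 20787.e1, now a typed per-pair shape at `(E, 3)`.
* §4 the tower FED on X8 (`p = 3`, `a_3 = ±3`): surj(3) + ONE Frobenius mod `9` (gen 16 p250381,
  `towerSurj_of_frobenius_of_eq_three`), surj(3) + (ram@3) (p249251), semistable + modularity +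
  Ribet–Diamond (p249601); on X7@3 (`a_3 = 0`, not semistable): surj(3) + Frobenius / (ram@3); on X6@3
  (semistable, `a_3 = 0`): no certificate at all (Serre Prop. 21 i) + level-lowering).

NOT claimed: no class theorem; the EXISTENCE of the certificate (the `≤` half of Conjecture 1.10) is an
instrument output per pair (CLASS-CLOSURE B-4, cc-eng-6 KURX `k_n ≥ 2` profiles), never a theorem
here; nothing about 3Nn rows (no tower) or analytic rank `1`.

References: [Kim2025RefinedTNC] Thm. 1.1 ("BSD"), Cor. 1.7, §8.1.2 (ANNOUNCED, OPEN binder);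
[Sakamoto2024KolyvaginThree] Thm. 1.1; [Kim2022StructureSelmer] Thm. 1.9 (6), §1.5.1, Conj. 1.10;
[Wuthrich2014] Prop. 21 (p. 400); [GreenbergVatsal2000] Rem. 3.4; [Serre1972] Prop. 12, Prop. 21;
[SerreAbelianLadic1968] IV §3.4; [Ribet1990] Thm. 1.1; [Diamond1995RefinedSerre] Thm. 1.1;
[Miller2011LMS] Def. 1.1; HOME class-closure/N6/STATEMENT.md, WEEK-2026-08-28.md §10.
-/

noncomputable section

open scoped Classical MatrixGroups ModularForm

open CongruenceSubgroup WeierstrassCurve Literature.NumberTheory.EllipticCurves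
  Literature.NumberTheory.EllipticCurves.ModularForms
  Literature.NumberTheory.EllipticCurves.Rank1Residual
  Literature.NumberTheory.EllipticCurves.Rank1Residual.Typed
  Literature.NumberTheory.EllipticCurves.Wuthrich2014
  Summit.BirchSwinnertonDyer.Rank1Residual.Additive

namespace Summit.BirchSwinnertonDyer.Rank1Residual.Supersingular

variable (W : WeierstrassCurve ℚ) [W.IsElliptic] [W.IsGloballyMinimal]

/-! ### §3 THE EXACT BOUNDARY `BSD(E,3) ⟺ ∂^{(∞)}(δ̃) = ord₃ ∏ c_ℓ ⟺ ∂^{(∞)}(δ̃) ≤ ord₃ ∏ c_ℓ` and the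
level-`3^{t+1}` CERTIFICATE -/

/-- **`BSD(E,3) ⟺` Kim's Conjecture 1.10 at the pair** (good `3`, tower, `r_an = 0`): Miller's
`BSD(E,3)` holds iff `X4.KimTamagawaDefectAt W 3 D.f` (`∂^{(∞)}(δ̃) = ord₃ ∏ c_ℓ`), CONDITIONAL on
`hK25s` (OPEN) alone — no Wuthrich. The `p ≥ 5` published twin is n1011's
`X4.bsdp_iff_eq_tamagawa_of_rankZero_witness` ∘ Kim 2026. Per pair; NOT a class theorem.
[claim: Kim2025RefinedTNC, status: under-review] [cite: Kim2025RefinedTNC, Thm. 1.1 ("BSD"), Cor. 1.7 (ANNOUNCED, OPEN binder)]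
[cite: Kim2022StructureSelmer, Thm. 1.9 (6) and Conj. 1.10 (PDF p. 8)] [cite: Miller2011LMS, Def. 1.1] -/
theorem GoodThree.bsdp_iff_kimTamagawaDefectAt_of_kim2025_OPEN
    (hK25s : Kim2025.thm11_kimShaLength_of_integralPeriod_OPEN)
    (hGZK : rank_eq_analyticRank_of_analyticRank_le_one) (hmod : hasEntireLFunction_rat)
    (h3per : realPeriodRat_eq_unit_mul_plusPeriod_three)
    (hgood : W.HasGoodReductionAtPrime 3) (hr : W.analyticRank = 0)
    (htower : ∀ n : ℕ, W.HasSurjectiveModNGaloisRep (3 ^ n : ℕ))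
    {N : ℕ} [NeZero N] (D : ModularParametrizationData W N) :
    BSDp W 3 ↔ X4.KimTamagawaDefectAt W 3 D.f := by
  obtain ⟨q, d, hq, hd, hval⟩ :=
    GoodThree.kimShaLengthRankZeroAt_of_kim2025_OPEN W hK25s hGZK hmod h3per hgood hr htower D
  have hL : W.entireLFunction 1 ≠ 0 := (W.analyticRank_eq_zero_iff_holds (hmod W)).mp hr
  obtain ⟨hmw, hfin⟩ := hGZK W (by rw [hr]; exact zero_le_one)
  have hirr : Irr W 3 := (GoodThree.surj_and_irr_of_tower W htower).2
  rw [X4.bsdp_iff_eq_tamagawa_of_rankZero_witness W 3 hmw hfin hL hirr hq hval, X4.KimTamagawaDefectAt,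
    hd]
  exact ⟨fun h => by rw [h], fun h => by exact_mod_cast h⟩

/-- **`BSD(E,3) ⟺` the `≤` half `∂^{(∞)}(δ̃) ≤ ord₃ ∏ c_ℓ`** (good `3`, tower, `r_an = 0`): the `≥` half
being a THEOREM modulo the preprint (§2, Wuthrich), `BSD(E,3)` is EQUIVALENT to the typed `≤` half
`X4.KimTamagawaDefectLeAt W 3 D.f` — i.e. to the LOWER half `MissingLowerBoundAt W 3` —, CONDITIONAL on
`hK25s` (OPEN) + `hW` (PUBLISHED). Per pair; NOT a class theorem. [claim: Kim2025RefinedTNC, status: under-review]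
[cite: Kim2025RefinedTNC, Thm. 1.1 ("BSD") (ANNOUNCED, OPEN binder)] [cite: Wuthrich2014, Prop. 21 (p. 400)]
[cite: Kim2022StructureSelmer, Conj. 1.10 (PDF p. 8)] [cite: Miller2011LMS, Def. 1.1] -/
theorem GoodThree.bsdp_iff_kimTamagawaDefectLeAt_of_kim2025_OPEN_of_wuthrich
    (hK25s : Kim2025.thm11_kimShaLength_of_integralPeriod_OPEN) (hW : sha_dvd_analyticSha)
    (hGZK : rank_eq_analyticRank_of_analyticRank_le_one) (hmod : hasEntireLFunction_rat)
    (h3per : realPeriodRat_eq_unit_mul_plusPeriod_three)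
    (hgood : W.HasGoodReductionAtPrime 3) (hr : W.analyticRank = 0)
    (htower : ∀ n : ℕ, W.HasSurjectiveModNGaloisRep (3 ^ n : ℕ))
    {N : ℕ} [NeZero N] (D : ModularParametrizationData W N) :
    BSDp W 3 ↔ X4.KimTamagawaDefectLeAt W 3 D.f := by
  rw [GoodThree.bsdp_iff_kimTamagawaDefectAt_of_kim2025_OPEN W hK25s hGZK hmod h3per hgood hr htower D,
    X4.kimTamagawaDefectAt_iff]
  exact ⟨fun h => h.1, fun h => ⟨h,
    GoodThree.kimTamagawaDefectGeAt_of_kim2025_OPEN_of_wuthrich W hK25s hW hGZK hmod h3per hgood hr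
      htower D⟩⟩

/-- **`BSD(E,3)` from ONE level-`3^{t+1}` Kurihara number** (good `3`, tower, `r_an = 0`): a cyclic
Kolyvagin level `n ∈ 𝒩_k` (`ℓ ∤ 3N`, `ℓ ≡ 1`, `a_ℓ ≡ ℓ + 1 (mod 3^k)`, `#Ẽ(𝔽_ℓ)[3] ≤ 3` at `ℓ ∣ n`) with
`k ≤ ord₃ ∏ c_ℓ + 1`, surjective discrete logarithms `ψ_ℓ : (ℤ/ℓ)ˣ ↠ ℤ/3^k`, and
`kuriharaNumber D.f (3^k) n ψ ≠ 0` give `BSD(E,3)` — BOTH halves: the LOWER one from the certificate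
(`∂^{(∞)} ≤ k − 1 ≤ t`), the UPPER one Wuthrich's. CONDITIONAL on `hK25s` (OPEN) + `hW` (PUBLISHED).
By §2 necessarily `k = t + 1`. On `3 ∤ ∏ c_ℓ` rows (`k = 1`) this is gen 17's unit route
(`GoodThree.bsdp_of_kim2025_OPEN_of_kuriharaUnitAt`, there with a Manin binder); on N6's TAM-DEFECT
rows it is the level-`𝒩₂` reading of Kim–Pollack App. §8.1.2. Per pair; NOT a class theorem.
[claim: Kim2025RefinedTNC, status: under-review] [cite: Kim2025RefinedTNC, Thm. 1.1 ("BSD"), §8.1.2 (ANNOUNCED, OPEN binder)]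
[cite: Wuthrich2014, Prop. 21 (p. 400)] [cite: Kim2022StructureSelmer, §1.5.1 (PDF p. 7), Conj. 1.10 (PDF p. 8)]
[cite: Miller2011LMS, Def. 1.1] -/
theorem GoodThree.bsdp_of_kim2025_OPEN_of_wuthrich_of_kuriharaNumber_ne_zero
    (hK25s : Kim2025.thm11_kimShaLength_of_integralPeriod_OPEN) (hW : sha_dvd_analyticSha)
    (hGZK : rank_eq_analyticRank_of_analyticRank_le_one) (hmod : hasEntireLFunction_rat)
    (h3per : realPeriodRat_eq_unit_mul_plusPeriod_three)
    (hgood : W.HasGoodReductionAtPrime 3) (hr : W.analyticRank = 0)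
    (htower : ∀ n : ℕ, W.HasSurjectiveModNGaloisRep (3 ^ n : ℕ))
    {N : ℕ} [NeZero N] (D : ModularParametrizationData W N)
    {n k : ℕ} [NeZero n] (hcyc : IsCyclicKolyvaginLevel W 3 n) (hn : Kato.IsKolyvaginProduct W 3 k n)
    (hk : k ≤ padicValNat 3 W.tamagawaProduct + 1)
    (ψ : (ℓ : ℕ) → (ZMod ℓ)ˣ →* Multiplicative (ZMod (3 ^ k)))
    (hψ : ∀ ℓ ∈ n.primeFactors, Function.Surjective (ψ ℓ))
    (hne : kuriharaNumber D.f (3 ^ k) n ψ ≠ 0) : BSDp W 3 := by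
  rw [GoodThree.bsdp_iff_kimTamagawaDefectLeAt_of_kim2025_OPEN_of_wuthrich W hK25s hW hGZK hmod h3per
    hgood hr htower D]
  unfold X4.KimTamagawaDefectLeAt
  refine (kuriharaPartialInfty_le_pred_of_ne_zero W 3 D.f hcyc hn ψ hψ hne).trans ?_
  exact_mod_cast (by omega : k - 1 ≤ padicValNat 3 W.tamagawaProduct)

/-- **The exact boundary in CERTIFICATE currency** (good `3`, tower, `r_an = 0`): `BSD(E,3)` holds
IFF some Kurihara number at a cyclic level `n ∈ 𝒩_k` with `1 ≤ k ≤ ord₃ ∏ c_ℓ + 1` is non-zero modulo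
`3^k` (then `k = t + 1` by §2), CONDITIONAL on `hK25s` (OPEN) + `hW` (PUBLISHED). So on every such
pair the `3`-part of BSD in rank `0` IS the existence of one finite certificate — the object the
CLASS-CLOSURE instrument B-4 (cc-eng-6 KURX, `k_n`-profiles) searches for. Per pair; NOT a class
theorem; the existence itself (Kim's Conjecture 1.10 `≤` half) is NOT claimed.
[claim: Kim2025RefinedTNC, status: under-review] [cite: Kim2025RefinedTNC, Thm. 1.1 ("BSD") (ANNOUNCED, OPEN binder)]
[cite: Wuthrich2014, Prop. 21 (p. 400)] [cite: Kim2022StructureSelmer, §1.5.1, Conj. 1.10 (PDF pp. 7–8)]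
[cite: Miller2011LMS, Def. 1.1] -/
theorem GoodThree.bsdp_iff_exists_kuriharaNumber_ne_zero_of_kim2025_OPEN_of_wuthrich
    (hK25s : Kim2025.thm11_kimShaLength_of_integralPeriod_OPEN) (hW : sha_dvd_analyticSha)
    (hGZK : rank_eq_analyticRank_of_analyticRank_le_one) (hmod : hasEntireLFunction_rat)
    (h3per : realPeriodRat_eq_unit_mul_plusPeriod_three)
    (hgood : W.HasGoodReductionAtPrime 3) (hr : W.analyticRank = 0)
    (htower : ∀ n : ℕ, W.HasSurjectiveModNGaloisRep (3 ^ n : ℕ))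
    {N : ℕ} [NeZero N] (D : ModularParametrizationData W N) :
    BSDp W 3 ↔
      ∃ (n k : ℕ) (hk : Kato.IsKolyvaginProduct W 3 k n), IsCyclicKolyvaginLevel W 3 n ∧
        1 ≤ k ∧ k ≤ padicValNat 3 W.tamagawaProduct + 1 ∧
        ∃ ψ : (ℓ : ℕ) → (ZMod ℓ)ˣ →* Multiplicative (ZMod (3 ^ k)),
          (∀ ℓ ∈ n.primeFactors, Function.Surjective (ψ ℓ)) ∧
          (haveI : NeZero n := ⟨hk.ne_zero⟩; kuriharaNumber D.f (3 ^ k) n ψ ≠ 0) := by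
  constructor
  · intro hB
    have hle : X4.KimTamagawaDefectLeAt W 3 D.f :=
      (GoodThree.bsdp_iff_kimTamagawaDefectLeAt_of_kim2025_OPEN_of_wuthrich W hK25s hW hGZK hmod h3per
        hgood hr htower D).mp hB
    exact X4.exists_certificate_of_kuriharaPartialInfty_le W 3 D.f hle
  · rintro ⟨n, k, hk, hcyc, -, hkt, ψ, hψ, hne⟩
    haveI : NeZero n := ⟨hk.ne_zero⟩
    exact GoodThree.bsdp_of_kim2025_OPEN_of_wuthrich_of_kuriharaNumber_ne_zero W hK25s hW hGZK hmod
      h3per hgood hr htower D hcyc hk hkt ψ hψ hne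

/-! ### §4 The tower FED: X8 (`a_3 = ±3`), X7@3 (`a_3 = 0`, not semistable), X6@3 (semistable) -/

variable (p : ℕ) [hp : Fact p.Prime]

/-- **X8 ∧ `r_an = 0` under the tower (generic prime symbol `p = 3` of the class): the Tamagawa defect
`X4.KimTamagawaDefectGeAt W p D.f`**, CONDITIONAL on `hK25s` (OPEN) + `hW` (PUBLISHED). Per pair.
[claim: Kim2025RefinedTNC, status: under-review] [cite: Kim2025RefinedTNC, Thm. 1.1 (ANNOUNCED, OPEN binder)]
[cite: Wuthrich2014, Prop. 21 (p. 400)] [cite: Kim2022StructureSelmer, Conj. 1.10 (PDF p. 8)] -/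
theorem X8RankZero.kimTamagawaDefectGeAt_of_kim2025_OPEN_of_wuthrich
    (hK25s : Kim2025.thm11_kimShaLength_of_integralPeriod_OPEN) (hW : sha_dvd_analyticSha)
    (hGZK : rank_eq_analyticRank_of_analyticRank_le_one) (hmod : hasEntireLFunction_rat)
    (h3per : realPeriodRat_eq_unit_mul_plusPeriod_three)
    (hr : W.analyticRank = 0) (hX : ClassX8 W p)
    (htower : ∀ n : ℕ, W.HasSurjectiveModNGaloisRep (p ^ n : ℕ))
    {N : ℕ} [NeZero N] (D : ModularParametrizationData W N) : X4.KimTamagawaDefectGeAt W p D.f := by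
  obtain ⟨rfl, hss, -⟩ := hX
  exact GoodThree.kimTamagawaDefectGeAt_of_kim2025_OPEN_of_wuthrich W hK25s hW hGZK hmod h3per hss.1 hr
    htower D

/-- **X8 ∧ `r_an = 0` under the tower: `BSD(E,3) ⟺` ONE Kurihara number non-zero modulo `3^k` at a
cyclic level of `𝒩_k`, `k ≤ ord₃ ∏ c_ℓ + 1`**, CONDITIONAL on `hK25s` (OPEN) + `hW` (PUBLISHED). The N6
reading: on the `3 ∤ ∏ c_ℓ` rows the certificate is a unit (`k = 1`), on the 7 TAM-DEFECT rows a
level-`𝒩₂` (or `𝒩_{t+1}`) number. Per pair; NOT a class theorem. [claim: Kim2025RefinedTNC, status: under-review]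
[cite: Kim2025RefinedTNC, Thm. 1.1, §8.1.2 (ANNOUNCED, OPEN binder)] [cite: Wuthrich2014, Prop. 21 (p. 400)]
[cite: Miller2011LMS, Def. 1.1] -/
theorem X8RankZero.bsdp_iff_exists_kuriharaNumber_ne_zero_of_kim2025_OPEN_of_wuthrich
    (hK25s : Kim2025.thm11_kimShaLength_of_integralPeriod_OPEN) (hW : sha_dvd_analyticSha)
    (hGZK : rank_eq_analyticRank_of_analyticRank_le_one) (hmod : hasEntireLFunction_rat)
    (h3per : realPeriodRat_eq_unit_mul_plusPeriod_three)
    (hr : W.analyticRank = 0) (hX : ClassX8 W p)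
    (htower : ∀ n : ℕ, W.HasSurjectiveModNGaloisRep (p ^ n : ℕ))
    {N : ℕ} [NeZero N] (D : ModularParametrizationData W N) :
    BSDp W p ↔
      ∃ (n k : ℕ) (hk : Kato.IsKolyvaginProduct W p k n), IsCyclicKolyvaginLevel W p n ∧
        1 ≤ k ∧ k ≤ padicValNat p W.tamagawaProduct + 1 ∧
        ∃ ψ : (ℓ : ℕ) → (ZMod ℓ)ˣ →* Multiplicative (ZMod (p ^ k)),
          (∀ ℓ ∈ n.primeFactors, Function.Surjective (ψ ℓ)) ∧
          (haveI : NeZero n := ⟨hk.ne_zero⟩; kuriharaNumber D.f (p ^ k) n ψ ≠ 0) := by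
  obtain ⟨rfl, hss, -⟩ := hX
  exact GoodThree.bsdp_iff_exists_kuriharaNumber_ne_zero_of_kim2025_OPEN_of_wuthrich W hK25s hW hGZK
    hmod h3per hss.1 hr htower D

/-- **N6, tower from surj(3) + ONE Frobenius mod `9`: `BSD(E,3)` from ONE level-`3^k` Kurihara number,
`k ≤ ord₃ ∏ c_ℓ + 1`** (X8 ∧ `r_an = 0`; lit-kato's certificate `ℓ ≡ 2,5 (9)`, `a_ℓ ≡ 3,6 (9)`, gen 16:
a witness `ℓ ≤ 1000` on every X8 S-b pair with `ρ̄_{E,3}` onto), CONDITIONAL on `hK25s` (OPEN) + `hW`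
(PUBLISHED); NO Manin binder, NO Tamagawa binder. The all-certificate shape the CLASS-CLOSURE instrument
B-4 feeds on N6's surj rows. Per pair; NOT a class theorem. [claim: Kim2025RefinedTNC, status: under-review]
[cite: Kim2025RefinedTNC, Thm. 1.1, §8.1.2 (ANNOUNCED, OPEN binder)] [cite: Wuthrich2014, Prop. 21 (p. 400)]
[cite: SerreAbelianLadic1968, Ch. IV §3.4, Lemma 3 (IV-23)] [cite: Miller2011LMS, Def. 1.1] -/
theorem X8RankZero.bsdp_three_of_kim2025_OPEN_of_wuthrich_of_kuriharaNumber_ne_zero_of_frobenius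
    (hK25s : Kim2025.thm11_kimShaLength_of_integralPeriod_OPEN) (hW : sha_dvd_analyticSha)
    (hGZK : rank_eq_analyticRank_of_analyticRank_le_one) (hmod : hasEntireLFunction_rat)
    (h3per : realPeriodRat_eq_unit_mul_plusPeriod_three)
    (hr : W.analyticRank = 0) (hX : ClassX8 W 3) (hs : Surj W 3)
    (ℓ : ℕ) [Fact ℓ.Prime] (hgood : W.HasGoodReductionAtPrime ℓ)
    (hℓ9 : ℓ % 9 = 2 ∨ ℓ % 9 = 5) (ha9 : W.frobeniusTrace ℓ % 9 = 3 ∨ W.frobeniusTrace ℓ % 9 = 6)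
    {N : ℕ} [NeZero N] (D : ModularParametrizationData W N)
    {n k : ℕ} [NeZero n] (hcyc : IsCyclicKolyvaginLevel W 3 n) (hn : Kato.IsKolyvaginProduct W 3 k n)
    (hk : k ≤ padicValNat 3 W.tamagawaProduct + 1)
    (ψ : (ℓ' : ℕ) → (ZMod ℓ')ˣ →* Multiplicative (ZMod (3 ^ k)))
    (hψ : ∀ ℓ' ∈ n.primeFactors, Function.Surjective (ψ ℓ'))
    (hne : kuriharaNumber D.f (3 ^ k) n ψ ≠ 0) : BSDp W 3 :=
  GoodThree.bsdp_of_kim2025_OPEN_of_wuthrich_of_kuriharaNumber_ne_zero W hK25s hW hGZK hmod h3per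
    hX.2.1.1 hr (towerSurj_of_frobenius_of_eq_three W 3 rfl hs ℓ hgood hℓ9 ha9) D hcyc hn hk ψ hψ hne

/-- **N6, tower from surj(3) + (ram@3)** (gen 16 `towerSurj_of_surj_of_ram`; census (ram@3) on 2 897
of 3 211 X8 S-b pairs): `BSD(E,3)` from ONE level-`3^k` Kurihara number, `k ≤ ord₃ ∏ c_ℓ + 1`,
CONDITIONAL on `hK25s` (OPEN) + `hW` (PUBLISHED). Per pair. [claim: Kim2025RefinedTNC, status: under-review]
[cite: Kim2025RefinedTNC, Thm. 1.1 (ANNOUNCED, OPEN binder)] [cite: Wuthrich2014, Prop. 21 (p. 400)]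
[cite: SerreAbelianLadic1968, Ch. IV §3.4 and A.1.2] [cite: Miller2011LMS, Def. 1.1] -/
theorem X8RankZero.bsdp_three_of_kim2025_OPEN_of_wuthrich_of_kuriharaNumber_ne_zero_of_ram
    (hK25s : Kim2025.thm11_kimShaLength_of_integralPeriod_OPEN) (hW : sha_dvd_analyticSha)
    (hGZK : rank_eq_analyticRank_of_analyticRank_le_one) (hmod : hasEntireLFunction_rat)
    (h3per : realPeriodRat_eq_unit_mul_plusPeriod_three)
    (hr : W.analyticRank = 0) (hX : ClassX8 W 3) (hs : Surj W 3) (hram : Ram W 3)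
    {N : ℕ} [NeZero N] (D : ModularParametrizationData W N)
    {n k : ℕ} [NeZero n] (hcyc : IsCyclicKolyvaginLevel W 3 n) (hn : Kato.IsKolyvaginProduct W 3 k n)
    (hk : k ≤ padicValNat 3 W.tamagawaProduct + 1)
    (ψ : (ℓ : ℕ) → (ZMod ℓ)ˣ →* Multiplicative (ZMod (3 ^ k)))
    (hψ : ∀ ℓ ∈ n.primeFactors, Function.Surjective (ψ ℓ))
    (hne : kuriharaNumber D.f (3 ^ k) n ψ ≠ 0) : BSDp W 3 :=
  GoodThree.bsdp_of_kim2025_OPEN_of_wuthrich_of_kuriharaNumber_ne_zero W hK25s hW hGZK hmod h3per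
    hX.2.1.1 hr (towerSurj_of_surj_of_ram W 3 hs hram) D hcyc hn hk ψ hψ hne

/-- **N6 ∩ {sst}, tower from modularity + Ribet–Diamond level-lowering, NO certificate for the image**
(gen 16 `ClassX8.towerSurj_of_semistable`): `BSD(E,3)` from ONE level-`3^k` Kurihara number,
`k ≤ ord₃ ∏ c_ℓ + 1`, CONDITIONAL on `hK25s` (OPEN) + `hW` (PUBLISHED). Per pair.
[claim: Kim2025RefinedTNC, status: under-review] [cite: Kim2025RefinedTNC, Thm. 1.1 (ANNOUNCED, OPEN binder)]
[cite: Wuthrich2014, Prop. 21 (p. 400)] [cite: Ribet1990, Thm. 1.1] [cite: Diamond1995RefinedSerre, Thm. 1.1]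
[cite: Serre1972, §5.4 Prop. 21 i)] [cite: Miller2011LMS, Def. 1.1] -/
theorem X8RankZero.bsdp_three_of_kim2025_OPEN_of_wuthrich_of_kuriharaNumber_ne_zero_of_semistable
    (hK25s : Kim2025.thm11_kimShaLength_of_integralPeriod_OPEN) (hW : sha_dvd_analyticSha)
    (hGZK : rank_eq_analyticRank_of_analyticRank_le_one) (hmod : hasEntireLFunction_rat)
    (h3per : realPeriodRat_eq_unit_mul_plusPeriod_three)
    (hmod' : exists_isNewformOf) (hLL : Literature.NumberTheory.Automorphic.diamond1995_refinedSerre)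
    (hr : W.analyticRank = 0) (hX : ClassX8 W 3) (hsst : Semistable W)
    {N : ℕ} [NeZero N] (D : ModularParametrizationData W N)
    {n k : ℕ} [NeZero n] (hcyc : IsCyclicKolyvaginLevel W 3 n) (hn : Kato.IsKolyvaginProduct W 3 k n)
    (hk : k ≤ padicValNat 3 W.tamagawaProduct + 1)
    (ψ : (ℓ : ℕ) → (ZMod ℓ)ˣ →* Multiplicative (ZMod (3 ^ k)))
    (hψ : ∀ ℓ ∈ n.primeFactors, Function.Surjective (ψ ℓ))
    (hne : kuriharaNumber D.f (3 ^ k) n ψ ≠ 0) : BSDp W 3 :=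
  GoodThree.bsdp_of_kim2025_OPEN_of_wuthrich_of_kuriharaNumber_ne_zero W hK25s hW hGZK hmod h3per
    hX.2.1.1 hr (ClassX8.towerSurj_of_semistable W 3 hmod' hLL hX hsst) D hcyc hn hk ψ hψ hne

/-- **N6's TAM-DEFECT rows carry NO unit Kurihara number** (X8 ∧ `r_an = 0` ∧ surj(3) + one Frobenius
mod `9` ∧ `3 ∣ ∏ c_ℓ`): `¬ X4.KuriharaUnitAt W 3 D.f`, CONDITIONAL on `hK25s` (OPEN) + `hW` (PUBLISHED)
— gen 17's `X8RankZero.not_kuriharaUnitAt_of_kim2025_OPEN_of_bsdp_of_dvd_tamagawaProduct` WITHOUT its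
`BSD(E,3)` hypothesis; matches the census (hyp X8R0-UPSET §1: 9950f1, 12155c1, 17200bj1, 18515u1 have
no unit at any cyclic level tried). Per pair. [claim: Kim2025RefinedTNC, status: under-review]
[cite: Kim2025RefinedTNC, Thm. 1.1, §8.1.2 (ANNOUNCED, OPEN binder)] [cite: Wuthrich2014, Prop. 21 (p. 400)]
[cite: SerreAbelianLadic1968, Ch. IV §3.4, Lemma 3 (IV-23)] -/
theorem X8RankZero.not_kuriharaUnitAt_of_kim2025_OPEN_of_wuthrich_of_dvd_tamagawaProduct_of_frobenius
    (hK25s : Kim2025.thm11_kimShaLength_of_integralPeriod_OPEN) (hW : sha_dvd_analyticSha)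
    (hGZK : rank_eq_analyticRank_of_analyticRank_le_one) (hmod : hasEntireLFunction_rat)
    (h3per : realPeriodRat_eq_unit_mul_plusPeriod_three)
    (hr : W.analyticRank = 0) (hX : ClassX8 W 3) (hs : Surj W 3)
    (ℓ : ℕ) [Fact ℓ.Prime] (hgood : W.HasGoodReductionAtPrime ℓ)
    (hℓ9 : ℓ % 9 = 2 ∨ ℓ % 9 = 5) (ha9 : W.frobeniusTrace ℓ % 9 = 3 ∨ W.frobeniusTrace ℓ % 9 = 6)
    {N : ℕ} [NeZero N] (D : ModularParametrizationData W N) (htam : 3 ∣ W.tamagawaProduct) :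
    ¬ X4.KuriharaUnitAt W 3 D.f :=
  GoodThree.not_kuriharaUnitAt_of_kim2025_OPEN_of_wuthrich_of_dvd_tamagawaProduct W hK25s hW hGZK hmod
    h3per hX.2.1.1 hr (towerSurj_of_frobenius_of_eq_three W 3 rfl hs ℓ hgood hℓ9 ha9) D htam

/-- **X7@3 ∧ `r_an = 0` ∧ surj(3) + ONE Frobenius mod `9` (N5@3's 10 Tam rows and 99 Tam-free rows
alike): `BSD(E,3)` from ONE level-`3^k` Kurihara number, `k ≤ ord₃ ∏ c_ℓ + 1`**, CONDITIONAL on `hK25s`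
(OPEN) + `hW` (PUBLISHED); NO Manin binder. Per pair; X7 joint pair, B side.
[claim: Kim2025RefinedTNC, status: under-review] [cite: Kim2025RefinedTNC, Thm. 1.1 (ANNOUNCED, OPEN binder)]
[cite: Wuthrich2014, Prop. 21 (p. 400)] [cite: SerreAbelianLadic1968, Ch. IV §3.4, Lemma 3 (IV-23)]
[cite: Miller2011LMS, Def. 1.1] -/
theorem X7.bsdp_three_of_kim2025_OPEN_of_wuthrich_of_kuriharaNumber_ne_zero_of_frobenius
    (hK25s : Kim2025.thm11_kimShaLength_of_integralPeriod_OPEN) (hW : sha_dvd_analyticSha)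
    (hGZK : rank_eq_analyticRank_of_analyticRank_le_one) (hmod : hasEntireLFunction_rat)
    (h3per : realPeriodRat_eq_unit_mul_plusPeriod_three)
    (hr : W.analyticRank = 0) (hX : ClassX7 W 3) (hs : Surj W 3)
    (ℓ : ℕ) [Fact ℓ.Prime] (hgood : W.HasGoodReductionAtPrime ℓ)
    (hℓ9 : ℓ % 9 = 2 ∨ ℓ % 9 = 5) (ha9 : W.frobeniusTrace ℓ % 9 = 3 ∨ W.frobeniusTrace ℓ % 9 = 6)
    {N : ℕ} [NeZero N] (D : ModularParametrizationData W N)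
    {n k : ℕ} [NeZero n] (hcyc : IsCyclicKolyvaginLevel W 3 n) (hn : Kato.IsKolyvaginProduct W 3 k n)
    (hk : k ≤ padicValNat 3 W.tamagawaProduct + 1)
    (ψ : (ℓ' : ℕ) → (ZMod ℓ')ˣ →* Multiplicative (ZMod (3 ^ k)))
    (hψ : ∀ ℓ' ∈ n.primeFactors, Function.Surjective (ψ ℓ'))
    (hne : kuriharaNumber D.f (3 ^ k) n ψ ≠ 0) : BSDp W 3 :=
  GoodThree.bsdp_of_kim2025_OPEN_of_wuthrich_of_kuriharaNumber_ne_zero W hK25s hW hGZK hmod h3per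
    hX.1.1 hr (towerSurj_of_frobenius_of_eq_three W 3 rfl hs ℓ hgood hℓ9 ha9) D hcyc hn hk ψ hψ hne

/-- **X6@3 ∧ `r_an = 0` (semistable, `a_3 = 0`; N4@3): `BSD(E,3)` from ONE level-`3^k` Kurihara number,
`k ≤ ord₃ ∏ c_ℓ + 1`, with NO image certificate at all** (surj(3) by `ClassX6.surj`, (ram@3) by `hmod'` +
`hLL`), CONDITIONAL on `hK25s` (OPEN) + `hW` (PUBLISHED); NO Manin binder. Per pair.
[claim: Kim2025RefinedTNC, status: under-review] [cite: Kim2025RefinedTNC, Thm. 1.1 (ANNOUNCED, OPEN binder)]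
[cite: Wuthrich2014, Prop. 21 (p. 400)] [cite: Ribet1990, Thm. 1.1] [cite: Diamond1995RefinedSerre, Thm. 1.1]
[cite: Serre1972, §5.4 Prop. 21 i)] [cite: Miller2011LMS, Def. 1.1] -/
theorem X6.bsdp_three_of_kim2025_OPEN_of_wuthrich_of_kuriharaNumber_ne_zero_of_levelLowering
    (hK25s : Kim2025.thm11_kimShaLength_of_integralPeriod_OPEN) (hW : sha_dvd_analyticSha)
    (hGZK : rank_eq_analyticRank_of_analyticRank_le_one) (hmod : hasEntireLFunction_rat)
    (h3per : realPeriodRat_eq_unit_mul_plusPeriod_three)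
    (hmod' : exists_isNewformOf) (hLL : Literature.NumberTheory.Automorphic.diamond1995_refinedSerre)
    (hr : W.analyticRank = 0) (hX : ClassX6 W 3)
    {N : ℕ} [NeZero N] (D : ModularParametrizationData W N)
    {n k : ℕ} [NeZero n] (hcyc : IsCyclicKolyvaginLevel W 3 n) (hn : Kato.IsKolyvaginProduct W 3 k n)
    (hk : k ≤ padicValNat 3 W.tamagawaProduct + 1)
    (ψ : (ℓ : ℕ) → (ZMod ℓ)ˣ →* Multiplicative (ZMod (3 ^ k)))
    (hψ : ∀ ℓ ∈ n.primeFactors, Function.Surjective (ψ ℓ))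
    (hne : kuriharaNumber D.f (3 ^ k) n ψ ≠ 0) : BSDp W 3 :=
  have hirr : Irr W 3 := ClassX6.irr W 3 (by decide) hX
  GoodThree.bsdp_of_kim2025_OPEN_of_wuthrich_of_kuriharaNumber_ne_zero W hK25s hW hGZK hmod h3per
    hX.1.1 hr
    (towerSurj_of_surj_of_ram W 3 (ClassX6.surj W 3 (by decide) hX)
      (ram_of_semistable_of_irr_of_le_seven hmod' hLL W 3 (by decide) (by decide) hX.2.1 hirr))
    D hcyc hn hk ψ hψ hne

end Summit.BirchSwinnertonDyer.Rank1Residual.Supersingular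

end
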